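import Summits.RiemannHypothesis.RiemannHypothesis.Theorems.RuelleBandExactFirstBandStubExpConvexDirichletRealAux
import Mathlib.Analysis.Complex.Convex
import HarnessLib

/-!
# Stub `stub_expConvexDirichlet_real` (line `Sketch`, heat cone) for the crux
`RuelleBand.ExactFirstBand` (item stmt-RiemannHypothesis-2061) — THE ENGINE

**An exponentially convex, locally finite Dirichlet series has real exponents.**
Pure analysis (no zeta).  Data: a countable index type `ι`, weights `w i > 0`, exponents
`l i ∈ ℂ` with `Re (l i) > 0`, only finitely many `i` with `Re (l i) ≤ C` for each `C`, and
`Σ_i w i e^{-t Re (l i)} < ∞` for every `t > 0`; the Dirichlet series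
`f t = Re Σ_i w i e^{-t l i}`.  Claim: if `f` is bounded-positive-definite on the semigroup
`((0,∞),+)` (tree `IsBoundedHalfLinePD`), then `Im (l i) = 0` for all `i`.

Proof (moments / generating-function pole argument).  Suppose `Im (l i₀) ≠ 0` and put
`δ = π/(2|Im l i₀|)`, `q_i = e^{-δ l i}` (so `q_{i₀}` is not real).  By the tree's Bernstein–Widder/GNS
theorem `IsBoundedHalfLinePD.exists_laplace_repr` (at `s = δ`) there is a finite positive measure `ν`
on `[0,∞)` with `f (2δ + t) = ∫ e^{-tE} dν(E)`, `t > 0`, so the samples `f ((k+3)δ)` are the moments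
`∫ e^{-(k+1)δE} dν` and their generating function is `g z = ∫ e^{-δE}/(1 - z e^{-δE}) dν`, holomorphic on
`{Im z ≠ 0}` and equal to `Σ_k z^k f((k+3)δ)` on the unit disc (landed stub
`stub_laplaceGeneratingFunction`).  On the Dirichlet side the same power series sums to
`h z = Σ_i (w i/2) (q_i³/(1 - z q_i) + q̄_i³/(1 - z q̄_i))` (absolutely convergent double series).
Among the indices with `q_i ∉ ℝ` pick `i₁` with `Re (l i₁)` minimal (finite sublevel sets), let
`r₀ = e^{δ Re l i₁} > 1` and `z₀ ∈ {1/q_{i₁}, 1/q̄_{i₁}}` the one with `Im z₀ > 0` (`|z₀| = r₀`).  On the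
convex open set `W = {|z| < r₀, Im z > 0}` no denominator vanishes (a pole `1/q_i` in `W` would be
non-real of modulus `< r₀`), `h` is holomorphic there (finite part + uniformly convergent tail on
`|z| < 2r₀`), `g` is holomorphic there, and `h = g` near `i/2`; hence `h = g` on `W` (identity theorem).
Along `z_t = t z₀`, `t ↑ 1`: `(1-t) g(z_t) → 0` (`g` is continuous at the non-real point `z₀`), while
`(1-t) h(z_t) → S := Σ (w i/2) q₀³ · #{q_i = q₀ or q̄_i = q₀} ≠ 0` (`q₀ = 1/z₀`; the pole terms have the
common denominator `1 - t` and positive total weight — no cancellation).  Contradiction.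
-/

set_option linter.dupNamespace false

noncomputable section

open Complex MeasureTheory Filter Set
open scoped Topology ComplexConjugate BigOperators

namespace Summit.RiemannHypothesis.RiemannHypothesis.Theorems.RuelleBandExactFirstBand

open Literature.Analysis.OperatorTheory

/-! ### The engine -/

/-- `sin (π/(2|b|) · b) ≠ 0` for `b ≠ 0` (it is `±1`). [folklore] -/
theorem stub_expConvexDirichlet_real_sin_ne_zero {b : ℝ} (hb : b ≠ 0) :
    Real.sin (Real.pi / (2 * |b|) * b) ≠ 0 := by
  rcases lt_or_gt_of_ne hb with hb' | hb'
  · have : Real.pi / (2 * |b|) * b = -(Real.pi / 2) := by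
      rw [abs_of_neg hb']
      field_simp
    rw [this, Real.sin_neg, Real.sin_pi_div_two]
    norm_num
  · have : Real.pi / (2 * |b|) * b = Real.pi / 2 := by
      rw [abs_of_pos hb']
      field_simp
    rw [this, Real.sin_pi_div_two]
    norm_num

/-- **Stub `stub_expConvexDirichlet_real`** (registered signature) — THE ENGINE of line `Sketch`:
an exponentially convex (bounded positive definite on `((0,∞),+)`), locally finite Dirichlet series
`t ↦ Re Σ_i w i e^{-t l i}` with positive weights has all its exponents `l i` real.  Proof in the
file header (Bernstein–Widder moments + generating-function pole argument). [folklore] -/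
theorem stub_expConvexDirichlet_real :
    ∀ (ι : Type) [Countable ι] (w : ι → ℝ) (l : ι → ℂ),
      (∀ i, 0 < w i) → (∀ i, 0 < (l i).re) → (∀ C : ℝ, {i | (l i).re ≤ C}.Finite) →
      (∀ t : ℝ, 0 < t → Summable (fun i => w i * Real.exp (-(t * (l i).re)))) →
      IsBoundedHalfLinePD (fun t : ℝ => (∑' i, ((w i : ℝ) : ℂ) * cexp (-((t : ℂ) * l i))).re) →
      ∀ i, (l i).im = 0 := by
  intro ι _ w l hw hl hfin hsum hPD
  classical
  by_contra hcon
  push Not at hcon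
  obtain ⟨i₀, hi₀⟩ := hcon
  -- the Dirichlet series as a named function
  set f : ℝ → ℝ := fun t : ℝ => (∑' i, ((w i : ℝ) : ℂ) * cexp (-((t : ℂ) * l i))).re with hf
  -- Step 1: the step `δ` and the numbers `q i = e^{-δ l i}`
  set b : ℝ := (l i₀).im with hb
  set δ : ℝ := Real.pi / (2 * |b|) with hδ_def
  have hδ : 0 < δ := by
    rw [hδ_def]
    exact div_pos Real.pi_pos (mul_pos two_pos (abs_pos.2 hi₀))
  set q : ι → ℂ := fun i => cexp (-((δ : ℂ) * l i)) with hq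
  have hq_norm : ∀ i, ‖q i‖ = Real.exp (-(δ * (l i).re)) := fun i =>
    stub_dirichletSide_norm_cexp δ (l i)
  have hq_norm' : ∀ i, ‖q i‖⁻¹ = Real.exp (δ * (l i).re) := fun i => by
    rw [hq_norm, ← Real.exp_neg, neg_neg]
  have hq_ne : ∀ i, q i ≠ 0 := fun i => Complex.exp_ne_zero _
  have hq_im : ∀ i, (q i).im = -(Real.exp (-(δ * (l i).re)) * Real.sin (δ * (l i).im)) := by
    intro i
    simp only [hq, Complex.exp_im, Complex.neg_re, Complex.neg_im, Complex.mul_re, Complex.mul_im,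
      Complex.ofReal_re, Complex.ofReal_im, zero_mul, sub_zero, add_zero, Real.sin_neg]
    ring
  have hqi₀ : (q i₀).im ≠ 0 := by
    rw [hq_im, neg_ne_zero]
    exact mul_ne_zero (Real.exp_pos _).ne' (stub_expConvexDirichlet_real_sin_ne_zero hi₀)
  -- Step 2: the non-real `q i` of least `Re (l i)`
  set F : Finset ι := (hfin (l i₀).re).toFinset.filter (fun i => (q i).im ≠ 0) with hF
  have hi₀F : i₀ ∈ F := by
    rw [hF, Finset.mem_filter, Set.Finite.mem_toFinset]
    exact ⟨show (l i₀).re ≤ (l i₀).re from le_rfl, hqi₀⟩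
  obtain ⟨i₁, hi₁F, hi₁min⟩ := F.exists_min_image (fun i => (l i).re) ⟨i₀, hi₀F⟩
  have hqi₁ : (q i₁).im ≠ 0 := by
    rw [hF, Finset.mem_filter] at hi₁F
    exact hi₁F.2
  have hmin : ∀ i, (q i).im ≠ 0 → (l i₁).re ≤ (l i).re := by
    intro i hi
    by_cases hle : (l i).re ≤ (l i₀).re
    · refine hi₁min i ?_
      rw [hF, Finset.mem_filter, Set.Finite.mem_toFinset]
      exact ⟨hle, hi⟩
    · have h0 : (l i₁).re ≤ (l i₀).re := hi₁min i₀ hi₀F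
      linarith
  set r₀ : ℝ := Real.exp (δ * (l i₁).re) with hr₀
  have hr₀_pos : 0 < r₀ := Real.exp_pos _
  have hr₀_one : 1 < r₀ := by
    rw [hr₀]
    exact Real.one_lt_exp_iff.2 (mul_pos hδ (hl i₁))
  -- the dichotomy: every `q i` (and its conjugate) is real or has `‖·‖⁻¹ ≥ r₀`
  have hdich : ∀ i, ((q i).im = 0 ∨ r₀ ≤ ‖q i‖⁻¹) ∧ ((conj (q i)).im = 0 ∨ r₀ ≤ ‖conj (q i)‖⁻¹) := by
    intro i
    rw [Complex.norm_conj, Complex.conj_im, neg_eq_zero]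
    by_cases hi : (q i).im = 0
    · exact ⟨Or.inl hi, Or.inl hi⟩
    · have h : r₀ ≤ ‖q i‖⁻¹ := by
        rw [hq_norm', hr₀]
        exact Real.exp_le_exp.2 (mul_le_mul_of_nonneg_left (hmin i hi) hδ.le)
      exact ⟨Or.inr h, Or.inr h⟩
  -- Step 3: the pole `z₀ = 1/q₀`, `q₀ ∈ {q i₁, q̄ i₁}` with `Im q₀ < 0`
  set q₀ : ℂ := if (q i₁).im < 0 then q i₁ else conj (q i₁) with hq₀
  have hq₀_cases : q i₁ = q₀ ∨ conj (q i₁) = q₀ := by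
    rw [hq₀]; split_ifs <;> simp
  have hq₀_im : q₀.im < 0 := by
    rw [hq₀]
    split_ifs with h
    · exact h
    · rw [Complex.conj_im, neg_lt_zero]
      exact lt_of_le_of_ne (not_lt.1 h) (Ne.symm hqi₁)
  have hq₀_norm : ‖q₀‖ = r₀⁻¹ := by
    have : ‖q₀‖ = ‖q i₁‖ := by rw [hq₀]; split_ifs <;> simp
    rw [this, ← inv_inv ‖q i₁‖, hq_norm' i₁]
  have hq₀_ne : q₀ ≠ 0 := by
    intro h; rw [h, Complex.zero_im] at hq₀_im; exact lt_irrefl _ hq₀_im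
  set z₀ : ℂ := q₀⁻¹ with hz₀
  have hz₀_im : 0 < z₀.im := by
    rw [hz₀, Complex.inv_im]
    exact div_pos (neg_pos.2 hq₀_im) (Complex.normSq_pos.2 hq₀_ne)
  have hz₀_norm : ‖z₀‖ = r₀ := by rw [hz₀, norm_inv, hq₀_norm, inv_inv]
  have hz₀q₀ : z₀ * q₀ = 1 := by rw [hz₀, inv_mul_cancel₀ hq₀_ne]
  -- Step 4: the measure side (Bernstein–Widder moments and their generating function `g`)
  obtain ⟨ν, hνfin, hν0, hrep⟩ := hPD.exists_laplace_repr hδ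
  set g : ℂ → ℂ := fun z => ∫ E, cexp (-((δ : ℂ) * E)) / (1 - z * cexp (-((δ : ℂ) * E))) ∂ν with hg
  obtain ⟨hg_diff, hg_sum⟩ := stub_laplaceGeneratingFunction ν hν0 δ hδ
  have hmoment : ∀ k : ℕ,
      ∫ E, cexp (-(((k : ℂ) + 1) * δ * E)) ∂ν = ((f (((k : ℝ) + 3) * δ) : ℝ) : ℂ) := by
    intro k
    have h1 : (fun E : ℝ => cexp (-(((k : ℂ) + 1) * δ * E))) =
        fun E : ℝ => cexp (-(((((k : ℝ) + 1) * δ : ℝ) : ℂ) * E)) := by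
      funext E
      push_cast
      ring_nf
    rw [h1, laplace_ofReal ν (((k : ℝ) + 1) * δ), ← hrep (((k : ℝ) + 1) * δ) (by positivity)]
    congr 2
    ring
  have hg_sum' : ∀ z : ℂ, ‖z‖ < 1 →
      HasSum (fun k : ℕ => z ^ k * ((f (((k : ℝ) + 3) * δ) : ℝ) : ℂ)) (g z) := by
    intro z hz
    have := hg_sum z hz
    simp only [hmoment] at this
    exact this
  -- Step 5: the Dirichlet side `h₀ z = Σ_i T i z` and `g = h₀` on the unit disc
  set T : ι → ℂ → ℂ := fun i z => (((w i : ℝ) : ℂ) / 2) *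
    (q i ^ 3 / (1 - z * q i) + conj (q i) ^ 3 / (1 - z * conj (q i))) with hT
  have hdir : ∀ z : ℂ, ‖z‖ < 1 → Summable (fun i => T i z) ∧
      HasSum (fun k : ℕ => z ^ k * ((f (((k : ℝ) + 3) * δ) : ℝ) : ℂ)) (∑' i, T i z) := fun z hz =>
    stub_dirichletSide_dirichlet_hasSum w l hw hl hsum hδ hz
  have hg_eq : ∀ z : ℂ, ‖z‖ < 1 → g z = ∑' i, T i z := fun z hz =>
    (hg_sum' z hz).unique (hdir z hz).2
  -- Step 6: the tail (holomorphic on `|z| < 2 r₀`) and the finite part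
  set R : ℝ := 2 * r₀ with hR
  have hR_pos : 0 < R := by positivity
  set A : ℝ := Real.log (4 * r₀) / δ with hA
  set s : Finset ι := (hfin A).toFinset with hs_def
  have hs_mem : ∀ i, i ∈ s ↔ (l i).re ≤ A := fun i => by
    rw [hs_def, Set.Finite.mem_toFinset]; rfl
  have hs_tail : ∀ i, i ∉ s → Real.exp (-(δ * (l i).re)) * R ≤ 1 / 2 := by
    intro i hi
    rw [hs_mem, not_le] at hi
    have h1 : Real.exp (-(δ * (l i).re)) < Real.exp (-(δ * A)) :=
      Real.exp_lt_exp.2 (by nlinarith)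
    have h2 : Real.exp (-(δ * A)) = (4 * r₀)⁻¹ := by
      rw [hA, mul_div_cancel₀ _ hδ.ne', Real.exp_neg, Real.exp_log (by positivity)]
    have h3 : Real.exp (-(δ * (l i).re)) * R ≤ (4 * r₀)⁻¹ * R :=
      mul_le_mul_of_nonneg_right (h1.trans_eq h2).le hR_pos.le
    calc Real.exp (-(δ * (l i).re)) * R ≤ (4 * r₀)⁻¹ * R := h3
      _ = 1 / 2 := by rw [hR]; field_simp; ring
  have hi₁s : i₁ ∈ s := by
    rw [hs_mem, hA, le_div_iff₀ hδ, mul_comm]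
    rw [Real.le_log_iff_exp_le (by positivity)]
    linarith
  set tail : ℂ → ℂ := fun z => ∑' i : {i // i ∉ s}, T i z with htail
  have htail_diff : DifferentiableOn ℂ tail (Metric.ball 0 R) :=
    stub_dirichletSide_tail_differentiableOn w l hw hsum hδ s hs_tail
  set h : ℂ → ℂ := fun z => ∑ i ∈ s, T i z + tail z with hh
  have hh_eq : ∀ z : ℂ, ‖z‖ < 1 → h z = ∑' i, T i z := fun z hz =>
    (hdir z hz).1.sum_add_tsum_subtype_compl s
  -- the wedge `W`
  set W : Set ℂ := Metric.ball (0 : ℂ) r₀ ∩ {z : ℂ | 0 < z.im} with hW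
  have hW_open : IsOpen W := Metric.isOpen_ball.inter (isOpen_lt continuous_const Complex.continuous_im)
  have hW_conn : IsPreconnected W := ((convex_ball (0 : ℂ) r₀).inter (convex_halfSpace_im_gt 0)).isPreconnected
  have hW_sub_R : W ⊆ Metric.ball (0 : ℂ) R := by
    rintro z ⟨hz, -⟩
    rw [Metric.mem_ball, dist_zero_right] at hz ⊢
    linarith
  have hW_sub_im : W ⊆ {z : ℂ | z.im ≠ 0} := fun z hz => ne_of_gt hz.2
  have hW_den : ∀ z ∈ W, ∀ i, 1 - z * q i ≠ 0 ∧ 1 - z * conj (q i) ≠ 0 := by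
    rintro z ⟨hz, hzi⟩ i
    rw [Metric.mem_ball, dist_zero_right] at hz
    exact ⟨stub_dirichletSide_nopole hz hzi (hdich i).1,
      stub_dirichletSide_nopole hz hzi (hdich i).2⟩
  have hT_diff : ∀ i, DifferentiableOn ℂ (T i) W := by
    intro i
    refine DifferentiableOn.mul (differentiableOn_const _) (DifferentiableOn.add ?_ ?_)
    · exact DifferentiableOn.div (differentiableOn_const _) (by fun_prop) fun z hz => (hW_den z hz i).1
    · exact DifferentiableOn.div (differentiableOn_const _) (by fun_prop) fun z hz => (hW_den z hz i).2
  have hh_diff : DifferentiableOn ℂ h W :=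
    (DifferentiableOn.fun_sum fun i _ => hT_diff i).add (htail_diff.mono hW_sub_R)
  have hg_diffW : DifferentiableOn ℂ g W := hg_diff.mono hW_sub_im
  -- `h = g` on `W` (identity theorem from the neighbourhood of `i/2`)
  set p : ℂ := ((1 / 2 : ℝ) : ℂ) * I with hp
  have hp_norm : ‖p‖ = 1 / 2 := by
    rw [hp, norm_mul, Complex.norm_real, Complex.norm_I, mul_one, Real.norm_of_nonneg (by norm_num)]
  have hp_im : p.im = 1 / 2 := by simp [hp]
  have hpW : p ∈ W := by
    refine ⟨?_, ?_⟩
    · rw [Metric.mem_ball, dist_zero_right, hp_norm]; linarith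
    · show 0 < p.im
      rw [hp_im]; norm_num
  have hp1 : p ∈ Metric.ball (0 : ℂ) 1 := by
    rw [Metric.mem_ball, dist_zero_right, hp_norm]; norm_num
  have hhg_nhds : h =ᶠ[𝓝 p] g := by
    filter_upwards [Metric.isOpen_ball.mem_nhds hp1] with z hz
    rw [Metric.mem_ball, dist_zero_right] at hz
    rw [hh_eq z hz, hg_eq z hz]
  have hEqOn : EqOn h g W :=
    (hh_diff.analyticOnNhd hW_open).eqOn_of_preconnected_of_eventuallyEq
      (hg_diffW.analyticOnNhd hW_open) hW_conn hpW hhg_nhds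
  -- Step 7: singular and regular parts of the finite sum at the pole `z₀ = 1/q₀`
  set Areg : ι → ℂ → ℂ := fun i z => if q i = q₀ then 0 else q i ^ 3 / (1 - z * q i) with hAreg
  set Breg : ι → ℂ → ℂ := fun i z =>
    if conj (q i) = q₀ then 0 else conj (q i) ^ 3 / (1 - z * conj (q i)) with hBreg
  set sing : ι → ℂ := fun i => (((w i : ℝ) : ℂ) / 2) *
    ((if q i = q₀ then q₀ ^ 3 else 0) + (if conj (q i) = q₀ then q₀ ^ 3 else 0)) with hsing
  have hT_split : ∀ i z, T i z =
      (((w i : ℝ) : ℂ) / 2) * (Areg i z + Breg i z) + sing i / (1 - z * q₀) := by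
    intro i z
    simp only [hT, hAreg, hBreg, hsing]
    split_ifs with h1 h2 h2 <;> (try rw [h2]) <;> (try rw [h1]) <;> ring
  set reg : ℂ → ℂ := fun z => ∑ i ∈ s, (((w i : ℝ) : ℂ) / 2) * (Areg i z + Breg i z) with hreg
  set Sng : ℂ := ∑ i ∈ s, sing i with hSng_def
  have hfin_split : ∀ z, ∑ i ∈ s, T i z = reg z + Sng / (1 - z * q₀) := by
    intro z
    simp_rw [hT_split]
    rw [Finset.sum_add_distrib, Finset.sum_div]
  -- the regular part is continuous at `z₀`
  have hz₀_inv : z₀⁻¹ = q₀ := by rw [hz₀, inv_inv]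
  have hAreg_cont : ∀ i, ContinuousAt (Areg i) z₀ := by
    intro i
    by_cases h1 : q i = q₀
    · have : Areg i = fun _ => 0 := by funext z; simp [hAreg, h1]
      rw [this]; exact continuousAt_const
    · have : Areg i = fun z => q i ^ 3 / (1 - z * q i) := by funext z; simp [hAreg, h1]
      rw [this]
      refine ContinuousAt.div continuousAt_const (by fun_prop) ?_
      intro h0
      apply h1
      have h0' : z₀ * q i = 1 := (sub_eq_zero.1 h0).symm
      rw [eq_inv_of_mul_eq_one_right h0', hz₀_inv]
  have hBreg_cont : ∀ i, ContinuousAt (Breg i) z₀ := by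
    intro i
    by_cases h1 : conj (q i) = q₀
    · have : Breg i = fun _ => 0 := by funext z; simp [hBreg, h1]
      rw [this]; exact continuousAt_const
    · have : Breg i = fun z => conj (q i) ^ 3 / (1 - z * conj (q i)) := by
        funext z; simp [hBreg, h1]
      rw [this]
      refine ContinuousAt.div continuousAt_const (by fun_prop) ?_
      intro h0
      apply h1
      have h0' : z₀ * conj (q i) = 1 := (sub_eq_zero.1 h0).symm
      rw [eq_inv_of_mul_eq_one_right h0', hz₀_inv]
  have hreg_cont : ContinuousAt reg z₀ :=
    tendsto_finsetSum s fun i _ => continuousAt_const.mul ((hAreg_cont i).add (hBreg_cont i))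
  -- the singular coefficient is non-zero (positive total weight, no cancellation)
  set N : ℝ := ∑ i ∈ s, w i * ((if q i = q₀ then 1 else 0) + (if conj (q i) = q₀ then 1 else 0)) with hN
  have hSng : Sng = q₀ ^ 3 / 2 * (N : ℂ) := by
    rw [hSng_def, hN, Complex.ofReal_sum, Finset.mul_sum]
    refine Finset.sum_congr rfl fun i _ => ?_
    simp only [hsing]
    split_ifs <;> push_cast <;> ring
  have hN_pos : 0 < N := by
    have hterm_nonneg : ∀ i ∈ s,
        0 ≤ w i * ((if q i = q₀ then 1 else 0) + (if conj (q i) = q₀ then 1 else 0) : ℝ) := by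
      intro i _
      refine mul_nonneg (hw i).le (add_nonneg ?_ ?_) <;> split_ifs <;> norm_num
    have hle := Finset.single_le_sum hterm_nonneg hi₁s
    have hi₁_ge : w i₁ ≤ w i₁ * ((if q i₁ = q₀ then 1 else 0) + (if conj (q i₁) = q₀ then 1 else 0) : ℝ) := by
      have hone : (1 : ℝ) ≤ (if q i₁ = q₀ then 1 else 0) + (if conj (q i₁) = q₀ then 1 else 0) := by
        rcases hq₀_cases with h | h
        · rw [if_pos h]
          have : (0 : ℝ) ≤ (if conj (q i₁) = q₀ then 1 else 0) := by split_ifs <;> norm_num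
          linarith
        · rw [if_pos h]
          have : (0 : ℝ) ≤ (if q i₁ = q₀ then 1 else 0) := by split_ifs <;> norm_num
          linarith
      calc w i₁ = w i₁ * 1 := (mul_one _).symm
        _ ≤ _ := mul_le_mul_of_nonneg_left hone (hw i₁).le
    rw [hN]
    linarith [hw i₁]
  have hSng_ne : Sng ≠ 0 := by
    rw [hSng]
    exact mul_ne_zero (div_ne_zero (pow_ne_zero 3 hq₀_ne) two_ne_zero)
      (Complex.ofReal_ne_zero.2 hN_pos.ne')
  -- Step 8: the limit along `z_t = t z₀`, `t ↑ 1`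
  set γ : ℝ → ℂ := fun t => (t : ℂ) * z₀ with hγ
  have hγW : ∀ t : ℝ, 0 < t → t < 1 → γ t ∈ W := by
    intro t ht0 ht1
    refine ⟨?_, ?_⟩
    · rw [Metric.mem_ball, dist_zero_right, hγ]
      dsimp only
      rw [norm_mul, Complex.norm_real, Real.norm_of_nonneg ht0.le, hz₀_norm]
      calc t * r₀ < 1 * r₀ := mul_lt_mul_of_pos_right ht1 hr₀_pos
        _ = r₀ := one_mul _
    · show 0 < ((t : ℂ) * z₀).im
      rw [Complex.im_ofReal_mul]
      exact mul_pos ht0 hz₀_im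
  have hγ_lim : Tendsto γ (𝓝[<] (1 : ℝ)) (𝓝 z₀) := by
    have hc : Continuous γ := by rw [hγ]; fun_prop
    have := hc.tendsto 1
    rw [show γ 1 = z₀ by simp [hγ]] at this
    exact this.mono_left nhdsWithin_le_nhds
  have h1t : Tendsto (fun t : ℝ => (1 - (t : ℂ))) (𝓝[<] (1 : ℝ)) (𝓝 0) := by
    have hc : Continuous fun t : ℝ => (1 - (t : ℂ)) := by fun_prop
    have := hc.tendsto 1
    rw [show (1 - ((1 : ℝ) : ℂ)) = 0 by simp] at this
    exact this.mono_left nhdsWithin_le_nhds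
  have hz₀R : z₀ ∈ Metric.ball (0 : ℂ) R := by
    rw [Metric.mem_ball, dist_zero_right, hz₀_norm, hR]; linarith
  have hg_cont : ContinuousAt g z₀ :=
    (hg_diff.differentiableAt
      ((isOpen_ne_fun Complex.continuous_im continuous_const).mem_nhds hz₀_im.ne')).continuousAt
  have htail_cont : ContinuousAt tail z₀ :=
    (htail_diff.differentiableAt (Metric.isOpen_ball.mem_nhds hz₀R)).continuousAt
  have L1 : Tendsto (fun t : ℝ => (1 - (t : ℂ)) * g (γ t)) (𝓝[<] (1 : ℝ)) (𝓝 0) := by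
    simpa using h1t.mul (hg_cont.tendsto.comp hγ_lim)
  have L2 : Tendsto (fun t : ℝ => Sng + (1 - (t : ℂ)) * (reg (γ t) + tail (γ t)))
      (𝓝[<] (1 : ℝ)) (𝓝 Sng) := by
    have := (h1t.mul ((hreg_cont.tendsto.comp hγ_lim).add (htail_cont.tendsto.comp hγ_lim))).const_add Sng
    simpa using this
  have hEv : ∀ᶠ t : ℝ in 𝓝[<] (1 : ℝ),
      Sng + (1 - (t : ℂ)) * (reg (γ t) + tail (γ t)) = (1 - (t : ℂ)) * g (γ t) := by
    filter_upwards [Ioo_mem_nhdsLT (zero_lt_one' ℝ)] with t ht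
    have hγt := hγW t ht.1 ht.2
    rw [← hEqOn hγt]
    show _ = (1 - (t : ℂ)) * (∑ i ∈ s, T i (γ t) + tail (γ t))
    rw [hfin_split]
    have hden : (1 : ℂ) - γ t * q₀ = 1 - (t : ℂ) := by
      show (1 : ℂ) - (t : ℂ) * z₀ * q₀ = 1 - (t : ℂ)
      rw [mul_assoc, hz₀q₀, mul_one]
    rw [hden]
    have hne : (1 : ℂ) - (t : ℂ) ≠ 0 := by
      rw [sub_ne_zero, ne_comm, Ne, Complex.ofReal_eq_one]
      exact ne_of_lt ht.2
    field_simp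
    ring
  have L1' : Tendsto (fun t : ℝ => (1 - (t : ℂ)) * g (γ t)) (𝓝[<] (1 : ℝ)) (𝓝 Sng) :=
    L2.congr' hEv
  exact hSng_ne (tendsto_nhds_unique L1' L1)
end Summit.RiemannHypothesis.RiemannHypothesis.Theorems.RuelleBandExactFirstBand

end
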